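import Literature.AnabelianGeometry.EtaleTheta.SettingModel2Coverings
import Literature.AnabelianGeometry.SemiGraphs.TemperedCompletionExtension
import Literature.AnabelianGeometry.SemiGraphs.ProSigmaCompletionSlim
import Literature.AnabelianGeometry.SemiGraphs.ProSigmaCompletionModels
import HarnessLib

/-!
# Topological automorphisms of `Γ = F̂₂ ×_Ẑ ℤ` preserve `Δ^tp_Y` and every `Δ^tp_{Y_N}`; `Γ` is centre-free

Mochizuki, *The étale theta function …*, Publ. RIMS **45** (2009) [EtTh], §1 pp. 12–13 («`Π^tp_Y`»,
«`Y_N → Y`») and Thm. 1.6 (i) p. 24 («γ(Π^tp_{Ÿα}) = Π^tp_{Ÿβ}»). abc-iut cell, layer L2, seat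
abc-iut-w5-d051 (gen 3; SUBDAG-EtTh-Thm16 lineage: leaf L04, clause TM, R44 «K3 at the root model»).
PROOF-ONLY (no definition, no named fact), over abc-iut-L2-t1's finer-model files `SettingModel2Curve`
(`Gfp`, `eHat`, `gfpFst`, `isProfiniteCompletion_gfpFst`), `SettingModel2Theta` (`hHat`),
`SettingModel2Coverings` (`dY`). The geometric group `Γ = F̂₂ ×_Ẑ ℤ = {(x, n) | ê x = ι n}`
(abc-iut-w5-d218's tempered fibre product) is shared by `ThetaSetting.model₂` and by the χ-twisted
model of the R78 cluster, so everything here serves both.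

* `le_ker_gfpSnd_of_isCompact`, `isCompact_ker_gfpSnd` — `Δ^tp_Y = Ker pr₂` is the UNIQUE MAXIMAL
  COMPACT subgroup of `Γ` (compact subgroups die in the discrete `ℤ`; `Ker pr₂ ≅ Ker ê` is closed in
  `F̂₂`), hence `map_ker_gfpSnd_eq`: every topological automorphism of `Γ` maps `Δ^tp_Y` onto itself
  (print: «immediate from the definitions; the discreteness of the topological group "Z"», p. 24);
* `hHat_y_apply_eq` — for ANY continuous endomorphism `Φ` of `F̂₂`, the `y`-coordinate (`b`-exponent
  mod `N`) of `ĥ_N ∘ Φ` is the linear form `c₁·x + c₂·y` in the coordinates of `ĥ_N`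
  (`c₁, c₂` = its values at `a`, `b`: two continuous homomorphisms to a finite group agreeing on the
  dense `η(F₂)`); on `Ker ê` (`x = 0`) it is `c₂·y`, and `c₂` is a UNIT as soon as `Φ(Ker ê) ∋ η b`;
* **`map_dY_eq`** — consequently every topological automorphism of `Γ` maps EACH `Δ^tp_{Y_N}`
  (`= Ker pr₂ ∩ ĥ_N⁻¹{x = y = 0}`, abc-iut-L2-t1's `dY N`) ONTO itself: extend it along the profinite
  completion `pr₁ : Γ → F̂₂` (abc-iut-w5-d139's `IsProfiniteCompletion.exists_extension`) and apply the
  previous item — the geometric half of «γ(Π^tp_{Yα}) = Π^tp_{Yβ}» at every level, with NO origin clause;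
* **`center_gfp_eq_bot`** — `Γ` is centre-free (`F̂₂` is centre-free: abc-iut-L5-t9's
  `IsProSigmaCompletion.center_eq_bot` at abc-iut-L3's model `isProSigmaCompletion_toCompletion`; `pr₁` is
  injective with dense image). Consumer: `SettingModel2Thm16i` (Thm. 1.6 (i) HOLDS at `model₂`).

Consistency evidence about semi-synthetic models only; nothing of [EtTh] is asserted for the genuine
tempered fundamental groups; no side is taken on [IUTchIII] Cor. 3.12; typed ≠ proved.
-/

noncomputable section

namespace Literature.AnabelianGeometry.EtaleTheta.SettingModel

open Literature.AnabelianGeometry.SemiGraphs Function Topology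

/-! ### 1. Continuous endomorphisms of `F̂₂` in the coordinates of `ĥ_N` -/

/-- **The `y`-coordinate of `ĥ_N ∘ Φ` is a linear form in the coordinates of `ĥ_N`**: for a continuous
endomorphism `Φ` of `F̂₂`, with `c₁ := y(ĥ_N(Φ(η a)))`, `c₂ := y(ĥ_N(Φ(η b)))`, one has
`y(ĥ_N(Φ x)) = c₁·x(ĥ_N x) + c₂·y(ĥ_N x)` for all `x ∈ F̂₂` (both sides are continuous homomorphisms to
the finite group `ℤ/N` agreeing on the generators, hence on the dense `η(F₂)`). [cite: MochizukiEtTh2009, §1 p.13] -/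
theorem hHat_y_apply_eq (Φ : F₂hatT →ₜ* F₂hatT) (N : ℕ+) (x : F₂hatT) :
    (hHat N (Φ x)).y =
      (hHat N (Φ (eta (FreeGroup.of 0)))).y * (hHat N x).x +
        (hHat N (Φ (eta (FreeGroup.of 1)))).y * (hHat N x).y := by
  set c₁ := (hHat N (Φ (eta (FreeGroup.of 0)))).y with hc₁
  set c₂ := (hHat N (Φ (eta (FreeGroup.of 1)))).y with hc₂
  -- the linear form `h ↦ c₁ h.x + c₂ h.y` as a homomorphism `Heis (ℤ/N) → ℤ/N`
  let L : Heis (ZMod N) →* Multiplicative (ZMod N) :=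
    MonoidHom.mk' (fun h => Multiplicative.ofAdd (c₁ * h.x + c₂ * h.y)) fun g h => by
      rw [← ofAdd_add]
      congr 1
      show c₁ * (g.x + h.x) + c₂ * (g.y + h.y) = c₁ * g.x + c₂ * g.y + (c₁ * h.x + c₂ * h.y)
      ring
  have hL : ∀ h : Heis (ZMod N), L h = Multiplicative.ofAdd (c₁ * h.x + c₂ * h.y) := fun _ => rfl
  -- the two continuous maps `F̂₂ → ℤ/N`
  have key : (fun x => Multiplicative.ofAdd (hHat N (Φ x)).y) = fun x => L (hHat N x) := by
    refine denseRange_eta.equalizer ?_ ?_ ?_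
    · exact (continuous_of_discreteTopology (f := fun h : Heis (ZMod N) => Multiplicative.ofAdd h.y)).comp
        ((hHat N).continuous.comp Φ.continuous)
    · exact (continuous_of_discreteTopology (f := fun h : Heis (ZMod N) => L h)).comp (hHat N).continuous
    · -- on `η(F₂)` both are homomorphisms `F₂ → ℤ/N` agreeing on the free generators
      have hom_eq : (Heis.yHom.comp ((hHat N).toMonoidHom.comp (Φ.toMonoidHom.comp eta))) =
          L.comp ((hHat N).toMonoidHom.comp eta) := by
        refine FreeGroup.ext_hom _ _ fun i => ?_
        fin_cases i
        · show Multiplicative.ofAdd (hHat N (Φ (eta (FreeGroup.of 0)))).y =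
            L (hHat N (eta (FreeGroup.of 0)))
          rw [hL, hHat_eta, heisHom_of_zero, Heis.map_apply]
          simp [← hc₁]
        · show Multiplicative.ofAdd (hHat N (Φ (eta (FreeGroup.of 1)))).y =
            L (hHat N (eta (FreeGroup.of 1)))
          rw [hL, hHat_eta, heisHom_of_one, Heis.map_apply]
          simp [← hc₂]
      funext g
      exact DFunLike.congr_fun hom_eq g
  have hx := congrFun key x
  simp only [hL] at hx
  exact Multiplicative.ofAdd.injective hx

/-- On `Ker ê` (where the `x`-coordinate of every `ĥ_N` vanishes) the `y`-coordinate of `ĥ_N ∘ Φ` is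
`c₂ · y`. [cite: MochizukiEtTh2009, §1 p.13] -/
theorem hHat_y_apply_eq_of_eHat_eq_one (Φ : F₂hatT →ₜ* F₂hatT) (N : ℕ+) {k : F₂hatT}
    (hk : eHat k = 1) :
    (hHat N (Φ k)).y = (hHat N (Φ (eta (FreeGroup.of 1)))).y * (hHat N k).y := by
  rw [hHat_y_apply_eq Φ N k, hHat_x_eq_zero_of_eHat_eq_one N hk, mul_zero, zero_add]

/-- If `Φ` maps some element of `Ker ê` to `η b`, the coefficient `c₂` is a unit of `ℤ/N`.
[cite: MochizukiEtTh2009, §1 p.13] -/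
theorem isUnit_coeff_of_exists (Φ : F₂hatT →ₜ* F₂hatT) (N : ℕ+)
    (hb : ∃ k : F₂hatT, eHat k = 1 ∧ Φ k = eta (FreeGroup.of 1)) :
    IsUnit (hHat N (Φ (eta (FreeGroup.of 1)))).y := by
  obtain ⟨k, hk, hΦk⟩ := hb
  have h := hHat_y_apply_eq_of_eHat_eq_one Φ N hk
  rw [hΦk, hHat_eta, heisHom_of_one, Heis.map_apply] at h
  simp only [map_one] at h
  exact IsUnit.of_mul_eq_one _ h.symm

/-- **The `b`-exponent mod `N` on `Ker ê` is preserved up to a unit**: for a continuous endomorphism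
`Φ` of `F̂₂` hitting `η b` from `Ker ê`, and `k ∈ Ker ê`: `y(ĥ_N(Φ k)) = 0 ↔ y(ĥ_N k) = 0`.
[cite: MochizukiEtTh2009, §1 p.13] -/
theorem hHat_y_apply_eq_zero_iff (Φ : F₂hatT →ₜ* F₂hatT) (N : ℕ+)
    (hb : ∃ k : F₂hatT, eHat k = 1 ∧ Φ k = eta (FreeGroup.of 1)) {k : F₂hatT} (hk : eHat k = 1) :
    (hHat N (Φ k)).y = 0 ↔ (hHat N k).y = 0 := by
  rw [hHat_y_apply_eq_of_eHat_eq_one Φ N hk]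
  exact (isUnit_coeff_of_exists Φ N hb).mul_right_eq_zero

/-! ### 2. `Δ^tp_Y = Ker pr₂` is the unique maximal compact subgroup of `Γ` -/

/-- `pr₂ : Γ → ℤ` is continuous. [cite: MochizukiEtTh2009, §1 p.12] -/
theorem continuous_gfpSnd : Continuous gfpSnd :=
  continuous_snd.comp continuous_subtype_val

/-- **Every compact subgroup of `Γ` lies in `Δ^tp_Y = Ker pr₂`**: its image in the discrete group `ℤ`
is a finite subgroup, hence trivial. [cite: MochizukiEtTh2009, §1 p.12] -/
theorem le_ker_gfpSnd_of_isCompact (C : Subgroup Gfp) (hC : IsCompact (C : Set Gfp)) :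
    C ≤ gfpSnd.ker := by
  intro g hg
  rw [MonoidHom.mem_ker]
  by_contra hne
  have hfin : (gfpSnd '' (C : Set Gfp)).Finite := (hC.image continuous_gfpSnd).finite_of_discrete
  have hm : Multiplicative.toAdd (gfpSnd g) ≠ 0 := by
    intro h0; exact hne (by rw [← ofAdd_toAdd (gfpSnd g), h0, ofAdd_zero])
  have hinj : Function.Injective fun n : ℕ => gfpSnd (g ^ n) := by
    intro n₁ n₂ h
    simp only [map_pow] at h
    have h' := congrArg Multiplicative.toAdd h
    rw [toAdd_pow, toAdd_pow, nsmul_eq_mul, nsmul_eq_mul] at h'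
    exact_mod_cast mul_right_cancel₀ hm h'
  exact hfin.not_infinite
    (Set.infinite_of_injective_forall_mem hinj fun n => ⟨g ^ n, C.pow_mem hg n, rfl⟩)

/-- The underlying set of `Ker pr₂` inside `F̂₂ × ℤ` is `Ker ê × {0}`. [cite: MochizukiEtTh2009, §1 p.12] -/
theorem image_val_ker_gfpSnd :
    Subtype.val '' ((gfpSnd.ker : Subgroup Gfp) : Set Gfp) =
      (eHat ⁻¹' {1}) ×ˢ ({1} : Set (Multiplicative ℤ)) := by
  ext ⟨x, n⟩
  constructor
  · rintro ⟨q, hq, hqx⟩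
    have hq' : (q : F₂hatT × Multiplicative ℤ).2 = 1 := hq
    rw [← hqx]
    refine ⟨?_, hq'⟩
    show eHat (q : F₂hatT × Multiplicative ℤ).1 ∈ ({1} : Set ZH)
    rw [(mem_Gfp _).mp q.2, hq', map_one]
    rfl
  · rintro ⟨hx, hn⟩
    have hn' : n = 1 := hn
    have hx' : eHat x = 1 := hx
    subst hn'
    exact ⟨⟨(x, 1), by rw [mem_Gfp, hx', map_one]⟩, (show (1 : Multiplicative ℤ) = 1 from rfl), rfl⟩

/-- **`Δ^tp_Y = Ker pr₂` is compact** (`≅ Ker ê`, closed in the profinite `F̂₂`). [cite: MochizukiEtTh2009, §1 p.12] -/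
theorem isCompact_ker_gfpSnd : IsCompact ((gfpSnd.ker : Subgroup Gfp) : Set Gfp) := by
  have h : IsCompact ((eHat ⁻¹' {1}) ×ˢ ({1} : Set (Multiplicative ℤ))) :=
    ((isClosed_singleton.preimage eHat.continuous).isCompact).prod isCompact_singleton
  rw [← image_val_ker_gfpSnd] at h
  exact Topology.IsInducing.subtypeVal.isCompact_iff.mpr h

/-- For `x ∈ Ker ê`, the element `(x, 0) ∈ Γ`. [cite: MochizukiEtTh2009, §1 p.12] -/
theorem mk_mem_Gfp_of_eHat_eq_one {x : F₂hatT} (hx : eHat x = 1) :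
    ((x, 1) : F₂hatT × Multiplicative ℤ) ∈ Gfp := by
  rw [mem_Gfp, hx, map_one]

/-- `pr₁` of an element of `Ker pr₂` lies in `Ker ê`. [cite: MochizukiEtTh2009, §1 p.12] -/
theorem eHat_gfpFst_eq_one {q : Gfp} (hq : q ∈ gfpSnd.ker) : eHat (gfpFst q) = 1 := by
  have hq' : (q : F₂hatT × Multiplicative ℤ).2 = 1 := hq
  rw [gfpFst_apply, (mem_Gfp _).mp q.2, hq', map_one]

/-- **Every topological automorphism of `Γ` maps `Δ^tp_Y = Ker pr₂` into itself** (compact subgroups go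
to compact subgroups). [cite: MochizukiEtTh2009, §1 p.12] -/
theorem map_ker_gfpSnd_le (γ : Gfp ≃ₜ* Gfp) :
    (gfpSnd.ker).map γ.toMulEquiv.toMonoidHom ≤ gfpSnd.ker := by
  refine le_ker_gfpSnd_of_isCompact _ ?_
  rw [Subgroup.coe_map]
  exact isCompact_ker_gfpSnd.image γ.continuous

/-- **Every topological automorphism of `Γ` maps `Δ^tp_Y = Ker pr₂` ONTO itself.**
[cite: MochizukiEtTh2009, §1 p.12] -/
theorem map_ker_gfpSnd_eq (γ : Gfp ≃ₜ* Gfp) :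
    (gfpSnd.ker).map γ.toMulEquiv.toMonoidHom = gfpSnd.ker := by
  refine le_antisymm (map_ker_gfpSnd_le γ) fun q hq => ?_
  refine ⟨γ.symm q, map_ker_gfpSnd_le γ.symm ⟨q, hq, rfl⟩, ?_⟩
  exact γ.apply_symm_apply q

/-- Membership form. [cite: MochizukiEtTh2009, §1 p.12] -/
theorem apply_mem_ker_gfpSnd_iff (γ : Gfp ≃ₜ* Gfp) (q : Gfp) :
    γ q ∈ gfpSnd.ker ↔ q ∈ gfpSnd.ker := by
  constructor
  · intro h
    have h' : γ.symm (γ q) ∈ (gfpSnd.ker).map γ.symm.toMulEquiv.toMonoidHom := ⟨γ q, h, rfl⟩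
    rw [map_ker_gfpSnd_eq] at h'
    simpa using h'
  · intro h
    have h' : γ q ∈ (gfpSnd.ker).map γ.toMulEquiv.toMonoidHom := ⟨q, h, rfl⟩
    rwa [map_ker_gfpSnd_eq] at h'

/-! ### 3. Every `Δ^tp_{Y_N}` is preserved -/

/-- The continuous extension of a topological automorphism of `Γ` to `F̂₂` along `pr₁` (a profinite
completion) maps `Ker ê` into `Ker ê` and hits `η b` from `Ker ê`. [cite: MochizukiEtTh2009, §1 p.12] -/
theorem extension_spec (γ : Gfp ≃ₜ* Gfp) {Φ : F₂hatT →ₜ* F₂hatT}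
    (hΦ : ∀ q : Gfp, Φ (gfpFst q) = gfpFst (γ q)) :
    (∀ k : F₂hatT, eHat k = 1 → eHat (Φ k) = 1) ∧
      ∃ k : F₂hatT, eHat k = 1 ∧ Φ k = eta (FreeGroup.of 1) := by
  refine ⟨fun k hk => ?_, ?_⟩
  · have h := hΦ ⟨(k, 1), mk_mem_Gfp_of_eHat_eq_one hk⟩
    rw [gfpFst_apply] at h
    change Φ k = _ at h
    rw [h]
    exact eHat_gfpFst_eq_one ((apply_mem_ker_gfpSnd_iff γ _).mpr rfl)
  · have hb : eHat (eta (FreeGroup.of 1)) = 1 := by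
      rw [eHat_eta, expA_apply, heisHom_of_one]; exact map_one _
    let qb : Gfp := ⟨(eta (FreeGroup.of 1), 1), mk_mem_Gfp_of_eHat_eq_one hb⟩
    have hqb : qb ∈ gfpSnd.ker := rfl
    refine ⟨gfpFst (γ.symm qb), eHat_gfpFst_eq_one ((apply_mem_ker_gfpSnd_iff γ.symm qb).mpr hqb), ?_⟩
    rw [hΦ, γ.apply_symm_apply]
    rfl

/-- **Every topological automorphism of `Γ` maps each `Δ^tp_{Y_N}` into itself.**
[cite: MochizukiEtTh2009, §1 p.13] -/
theorem map_dY_le_of_continuousMulEquiv (γ : Gfp ≃ₜ* Gfp) (N : ℕ+) : (dY N).map γ.toMulEquiv.toMonoidHom ≤ dY N := by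
  -- extend `pr₁ ∘ γ` along the profinite completion `pr₁ : Γ → F̂₂`
  obtain ⟨Φ, hΦ⟩ := isProfiniteCompletion_gfpFst.exists_extension
    (⟨gfpFst.toMonoidHom.comp γ.toMulEquiv.toMonoidHom, gfpFst.continuous.comp γ.continuous⟩ :
      Gfp →ₜ* F₂hatT)
  have hΦ' : ∀ q : Gfp, Φ (gfpFst q) = gfpFst (γ q) := fun q => hΦ q
  obtain ⟨-, hb⟩ := extension_spec γ hΦ'
  rintro _ ⟨q, hq, rfl⟩
  obtain ⟨hq1, hq2⟩ := Subgroup.mem_inf.mp hq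
  obtain ⟨-, hy⟩ := Subgroup.mem_comap.mp hq2
  have hγq : γ q ∈ gfpSnd.ker := (apply_mem_ker_gfpSnd_iff γ q).mpr hq1
  refine Subgroup.mem_inf.mpr ⟨hγq, Subgroup.mem_comap.mpr ⟨levelHom_x_eq_zero hγq, ?_⟩⟩
  change (hHat N (gfpFst (γ.toMulEquiv.toMonoidHom q))).y = 0
  change (hHat N (gfpFst q)).y = 0 at hy
  have e : gfpFst (γ.toMulEquiv.toMonoidHom q) = Φ (gfpFst q) := (hΦ' q).symm
  rw [e, hHat_y_apply_eq_zero_iff Φ N hb (eHat_gfpFst_eq_one hq1)]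
  exact hy

/-- **Every topological automorphism of `Γ` maps each `Δ^tp_{Y_N}` ONTO itself** («`γ(Π^tp_{Yα}) = Π^tp_{Yβ}`»,
geometric part, all levels). [cite: MochizukiEtTh2009, §1 p.13] -/
theorem map_dY_eq (γ : Gfp ≃ₜ* Gfp) (N : ℕ+) : (dY N).map γ.toMulEquiv.toMonoidHom = dY N := by
  refine le_antisymm (map_dY_le_of_continuousMulEquiv γ N) fun q hq => ?_
  exact ⟨γ.symm q, map_dY_le_of_continuousMulEquiv γ.symm N ⟨q, hq, rfl⟩, γ.apply_symm_apply q⟩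

/-- Membership form. [cite: MochizukiEtTh2009, §1 p.13] -/
theorem apply_mem_dY_iff (γ : Gfp ≃ₜ* Gfp) (N : ℕ+) (q : Gfp) : γ q ∈ dY N ↔ q ∈ dY N := by
  constructor
  · intro h
    have h' : γ.symm (γ q) ∈ (dY N).map γ.symm.toMulEquiv.toMonoidHom := ⟨γ q, h, rfl⟩
    rw [map_dY_eq] at h'
    simpa using h'
  · intro h
    have h' : γ q ∈ (dY N).map γ.toMulEquiv.toMonoidHom := ⟨q, h, rfl⟩
    rwa [map_dY_eq] at h'

/-! ### 4. `Γ` is centre-free -/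

/-- `F₂` is not abelian (`ab` and `ba` differ in the Heisenberg quotient). [folklore] -/
private theorem exists_mul_ne_F₂ : ∃ x y : F₂, x * y ≠ y * x := by
  refine ⟨FreeGroup.of 0, FreeGroup.of 1, fun h => ?_⟩
  have h' := congrArg (fun g => (heisHom g).z) h
  simp only [map_mul, heisHom_of_zero, heisHom_of_one] at h'
  change (0 : ℤ) + 0 + 1 * 1 = 0 + 0 + 0 * 0 at h'
  norm_num at h'

/-- **`F̂₂` is centre-free** (abc-iut-L5-t9's `ProSigmaCompletionSlim.center_eq_bot` at `Σ = {all primes}`,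
model `isProSigmaCompletion_toCompletion`). [cite: MochizukiAbsAnab2004, Lemma 1.3.1 p.15] -/
theorem center_F₂hat_eq_bot : Subgroup.center F₂hatT = ⊥ :=
  SemiGraphOfAnabelioids.IsProSigmaCompletion.center_eq_bot (Γ := F₂) (ι := eta) exists_mul_ne_F₂
    (SemiGraphOfAnabelioids.IsProSigmaCompletion.isProSigmaCompletion_toCompletion F₂)

/-- **`Γ = F̂₂ ×_Ẑ ℤ` is centre-free**: a central element of `Γ` has `pr₁` commuting with the dense
`pr₁(Γ)`, hence central in `F̂₂`, hence trivial; and `pr₁` is injective. [cite: MochizukiSemiAnbd2006, Ex 3.10 p.45] -/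
theorem center_gfp_eq_bot : Subgroup.center Gfp = ⊥ := by
  rw [eq_bot_iff]
  intro c hc
  rw [Subgroup.mem_center_iff] at hc
  have hcl : IsClosed {x : F₂hatT | x * gfpFst c = gfpFst c * x} :=
    isClosed_eq (continuous_id.mul continuous_const) (continuous_const.mul continuous_id)
  have hall : ∀ x : F₂hatT, x * gfpFst c = gfpFst c * x := by
    intro x
    refine isProfiniteCompletion_gfpFst.denseRange.induction_on x hcl fun q => ?_
    show gfpFst q * gfpFst c = gfpFst c * gfpFst q
    rw [← map_mul, ← map_mul, hc q]
  have hmem : gfpFst c ∈ Subgroup.center F₂hatT := Subgroup.mem_center_iff.mpr hall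
  rw [center_F₂hat_eq_bot, Subgroup.mem_bot] at hmem
  rw [Subgroup.mem_bot]
  exact gfpFst_injective (by rw [hmem, map_one])

end Literature.AnabelianGeometry.EtaleTheta.SettingModel

end
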